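import Summits.ResolutionOfSingularities.ResolutionOfSingularities.Theorems.PurelyInseparableDim4HasseSingleLetter
import Summits.ResolutionOfSingularities.ResolutionOfSingularities.Theorems.PurelyInseparableDim4ResConePowerCone
import Summits.ResolutionOfSingularities.ResolutionOfSingularities.Theorems.PurelyInseparableDim4ResConeResidualTransform
import HarnessLib
import HarnessLib.Audit.Tags

/-!
# Purely inseparable four-folds — GENERIC LEDGER ⇒ HASSE LEDGER: a boundary ledger `u·G ∈ (x_a, h^d)` transfers to
# the Hasse contact polynomial `D_c^{(d−1)} G` of any letter carrying `h` (slice-B architecture (K8))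

[OURS · counted 0 · cell `res-dim4-pi` · SLICE-B ARCHITECTURE OF RECORD `SLICE-B-ARCH-g3.md` v1.1 §5 (desk WORDs #88/#90,
idea-4 g3's intrinsic-ledger remark 23:09Z); seat res-dim4-p-12 g3.]  Nothing here proves K2(p), `NoIsolatedTrap p p` or
resolution of singularities in dimension ≥ 4 / characteristic `p`.  AI kernel work, weaker than expert review.

THE PROBLEM.  Along a slice-B stretch every stretch-born boundary letter `a` carries an intrinsic LEDGER
`u·G ∈ (x_a, h_a^d)` (`G = F/x^r` the residual polynomial of shade `d`, `u(0) ≠ 0`, `h_a ∈ 𝔪₀`; seed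
`…ResConeExceptionalRestriction` (K3), persistence (K4)), but I-4-7's (DL) kill (`…IsolatedPowerIdeal`, K1 ∘ K2) needs
the SAME contact polynomial for two letters.  THE ANSWER (maximal contact, `d < p`): every ledger transfers to the Hasse
contact polynomial `D_c^{(d−1)} G` of ANY letter `c ≠ a` on which `h` lives to first order:
* §2 `pow_mul_hasseDeriv_single_mem_span` — peeling: `u·G = S·x_a + T·h^d ⇒ u^{m+1}·D_c^{(m)}G ∈ (x_a, h^{d−m})`;
* §3 `exists_pow_mul_hasseDeriv_eq` — the key congruence `u^d·D_c^{(d−1)}G = e·x_a + h·w` with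
  `w(0) = u(0)^{d−1}·d·T(0)·(D_c^{(1)}h)(0)^{d−1}`; **`exists_unit_mul_mem_span_X_hasseDeriv_pow`** — for `1 ≤ d < p`
  (char `p`), `T(0) ≠ 0` and `(D_c^{(1)}h)(0) ≠ 0`: `∃ u′, u′(0) ≠ 0 ∧ u′·G ∈ (x_a, (D_c^{(d−1)}G)^d)`;
* §4 `forall_le_degree_pow'`, `eval_cofactor_ne_zero` (the cofactor `T` is a unit as soon as `G` has a degree-`d` monomial off `x_a`, i.e. its
  cone is not in `(x_a)`) and the membership form **`exists_unit_mul_mem_span_X_hasseDeriv_pow_of_mem`**.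
So two stretch-born ledgers `(a, h_a)`, `(b, h_b)` meet in `h := D_c^{(d−1)}G` for any `c ∉ {a, b}` with `ℓ(c) ≠ 0`;
(K2) merges, (K1) kills.  No contact-letter bookkeeping along the stretch is needed.
bears_on: LADDER-RESOLUTION:D157-DOOR2 (res-dim4-pi · K2(p) slice B · (K8)).  Supports
stmt-ResolutionOfSingularities-16155 (helper).
-/

set_option linter.dupNamespace false -- mandated namespace of this single-conjunct summit

noncomputable section

namespace Summit.ResolutionOfSingularities.ResolutionOfSingularities.Theorems.PIDim4

namespace IsolatedBand

open MvPolynomial Finset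
open Literature.AlgebraicGeometry.Resolution

variable {K : Type} [Field K]

/-! ## 2. Peeling a ledger through single-letter Hasse derivatives -/

/-- Shrinking the `h`-power inside the ledger ideal: `(x_a, h^j) ⊆ (x_a, h^k)` for `k ≤ j`. [folklore] -/
theorem span_X_pow_mono (a : Fin 4) (h : MvPolynomial (Fin 4) K) {j k : ℕ} (hkj : k ≤ j) :
    Ideal.span {(X a : MvPolynomial (Fin 4) K), h ^ j} ≤ Ideal.span {(X a : MvPolynomial (Fin 4) K), h ^ k} := by
  rw [Ideal.span_le]
  rintro x hx
  simp only [Set.mem_insert_iff, Set.mem_singleton_iff] at hx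
  rcases hx with rfl | rfl
  · exact Ideal.subset_span (by simp)
  · obtain ⟨i, rfl⟩ := Nat.exists_eq_add_of_le hkj
    rw [pow_add]
    exact Ideal.mul_mem_right _ _ (Ideal.subset_span (by simp))

/-- **Peeling**: from `u·G = S·x_a + T·h^d` every lower Hasse derivative in a letter `c ≠ a` satisfies
`u^{m+1} · D_c^{(m)} G ∈ (x_a, h^{d−m})`. [folklore] [cite: EGAIV4, Thm. 16.11.2 (16.11.2.2)] -/
theorem pow_mul_hasseDeriv_single_mem_span {a c : Fin 4} (hca : c ≠ a) {d : ℕ}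
    {G h u S T : MvPolynomial (Fin 4) K} (hG : u * G = S * X a + T * h ^ d) :
    ∀ m : ℕ, u ^ (m + 1) * hasseDeriv (Finsupp.single c m) G ∈
      Ideal.span {(X a : MvPolynomial (Fin 4) K), h ^ (d - m)} := by
  intro m
  induction m using Nat.strong_induction_on with
  | _ m ih =>
    have hXa : ∀ k, (X a : MvPolynomial (Fin 4) K) ∈ Ideal.span {(X a : MvPolynomial (Fin 4) K), h ^ k} :=
      fun k => Ideal.subset_span (by simp)
    -- `D^{(m)}(uG) ∈ (x_a, h^{d−m})`
    have hD : hasseDeriv (Finsupp.single c m) (u * G) ∈ Ideal.span {(X a : MvPolynomial (Fin 4) K), h ^ (d - m)} := by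
      rw [hG, Equimultiple.hasseDeriv_eq, map_add, ← Equimultiple.hasseDeriv_eq, ← Equimultiple.hasseDeriv_eq,
        mul_comm S, hasseDeriv_single_X_mul_of_ne hca, hasseDeriv_single_mul]
      refine Ideal.add_mem _ (Ideal.mul_mem_right _ _ (hXa _)) (Ideal.sum_mem _ fun i hi => ?_)
      exact Ideal.mul_mem_left _ _ (span_X_pow_mono a h (show d - m ≤ d - (m - i) by omega)
        (Ideal.mem_span_insert.mpr ⟨0, _, hasseDeriv_single_pow_mem_span c (m - i) d h, by rw [zero_mul, zero_add]⟩))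
    -- `D^{(m)}(uG) = u·D^{(m)}G + Σ_{i ≥ 1} D^{(i)}u · D^{(m−i)}G`
    have hexp := hasseDeriv_single_mul c m u G
    rw [Finset.sum_range_succ', hasseDeriv_single_zero', Nat.sub_zero] at hexp
    have hsum : u ^ (m + 1) * hasseDeriv (Finsupp.single c m) G =
        u ^ m * hasseDeriv (Finsupp.single c m) (u * G) -
          ∑ i ∈ Finset.range m, u ^ m * (hasseDeriv (Finsupp.single c (i + 1)) u *
            hasseDeriv (Finsupp.single c (m - (i + 1))) G) := by
      rw [hexp, mul_add, Finset.mul_sum, add_sub_cancel_left, pow_succ, mul_assoc]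
    rw [hsum]
    refine Ideal.sub_mem _ (Ideal.mul_mem_left _ _ hD) (Ideal.sum_mem _ fun i hi => ?_)
    rw [Finset.mem_range] at hi
    have hrec := ih (m - (i + 1)) (by omega)
    have hsplit : u ^ m * (hasseDeriv (Finsupp.single c (i + 1)) u * hasseDeriv (Finsupp.single c (m - (i + 1))) G) =
        u ^ (m - (m - (i + 1) + 1)) * hasseDeriv (Finsupp.single c (i + 1)) u *
          (u ^ (m - (i + 1) + 1) * hasseDeriv (Finsupp.single c (m - (i + 1))) G) := by
      rw [show u ^ m = u ^ (m - (m - (i + 1) + 1)) * u ^ (m - (i + 1) + 1) by rw [← pow_add]; congr 1; omega]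
      ring
    rw [hsplit]
    exact Ideal.mul_mem_left _ _ (span_X_pow_mono a h (by omega) hrec)

/-! ## 3. GENERIC LEDGER ⇒ HASSE LEDGER -/

/-- **THE KEY CONGRUENCE**: from `u·G = S·x_a + T·h^d` (`1 ≤ d`), for `D := D_c^{(d−1)}` with `c ≠ a`:
`u^d · D G = x_a · e + h · w` with `w(0) = u(0)^{d−1} · d · T(0) · (D_c^{(1)} h)(0)^{d−1}`. [OURS]
[cite: EGAIV4, Thm. 16.11.2 (16.11.2.2)] -/
theorem exists_pow_mul_hasseDeriv_eq {a c : Fin 4} (hca : c ≠ a) {d : ℕ} (hd : 1 ≤ d)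
    {G h u S T : MvPolynomial (Fin 4) K} (hh : h ∈ originIdeal K) (hG : u * G = S * X a + T * h ^ d) :
    ∃ e w : MvPolynomial (Fin 4) K,
      u ^ d * hasseDeriv (Finsupp.single c (d - 1)) G = e * X a + h * w ∧
      MvPolynomial.eval 0 w = MvPolynomial.eval 0 u ^ (d - 1) * d * MvPolynomial.eval 0 T *
        MvPolynomial.eval 0 (hasseDeriv (Finsupp.single c 1) h) ^ (d - 1) := by
  -- (i) `D^{(d−1)}(uG) − d·T·h·hasseDeriv (Finsupp.single c 1) h^{d−1} ∈ (x_a, h²)`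
  obtain ⟨-, hP⟩ := hasseDeriv_single_pow_congr c h d hd
  have hJ : hasseDeriv (Finsupp.single c (d - 1)) (u * G) -
      T * ((d : MvPolynomial (Fin 4) K) * h * hasseDeriv (Finsupp.single c 1) h ^ (d - 1)) ∈
      Ideal.span {(X a : MvPolynomial (Fin 4) K), h ^ 2} := by
    have hexp : hasseDeriv (Finsupp.single c (d - 1)) (u * G) =
        X a * hasseDeriv (Finsupp.single c (d - 1)) S +
          (T * hasseDeriv (Finsupp.single c (d - 1)) (h ^ d) +
            ∑ i ∈ Finset.range (d - 1), hasseDeriv (Finsupp.single c (i + 1)) T *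
              hasseDeriv (Finsupp.single c (d - 1 - (i + 1))) (h ^ d)) := by
      rw [hG, Equimultiple.hasseDeriv_eq, map_add, ← Equimultiple.hasseDeriv_eq, ← Equimultiple.hasseDeriv_eq,
        mul_comm S, hasseDeriv_single_X_mul_of_ne hca, hasseDeriv_single_mul, Finset.sum_range_succ',
        hasseDeriv_single_zero', Nat.sub_zero, add_comm (∑ i ∈ _, _)]
    rw [hexp, show X a * hasseDeriv (Finsupp.single c (d - 1)) S +
        (T * hasseDeriv (Finsupp.single c (d - 1)) (h ^ d) +
          ∑ i ∈ Finset.range (d - 1), hasseDeriv (Finsupp.single c (i + 1)) T *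
            hasseDeriv (Finsupp.single c (d - 1 - (i + 1))) (h ^ d)) -
        T * ((d : MvPolynomial (Fin 4) K) * h * hasseDeriv (Finsupp.single c 1) h ^ (d - 1)) =
      X a * hasseDeriv (Finsupp.single c (d - 1)) S +
        T * (hasseDeriv (Finsupp.single c (d - 1)) (h ^ d) - (d : MvPolynomial (Fin 4) K) * h * hasseDeriv (Finsupp.single c 1) h ^ (d - 1)) +
          ∑ i ∈ Finset.range (d - 1), hasseDeriv (Finsupp.single c (i + 1)) T *
            hasseDeriv (Finsupp.single c (d - 1 - (i + 1))) (h ^ d) by ring]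
    refine Ideal.add_mem _ (Ideal.add_mem _ (Ideal.mul_mem_right _ _ (Ideal.subset_span (by simp)))
      (Ideal.mul_mem_left _ _ (Ideal.mem_span_insert.mpr ⟨0, _, hP, by rw [zero_mul, zero_add]⟩)))
      (Ideal.sum_mem _ fun i hi => Ideal.mul_mem_left _ _ ?_)
    rw [Finset.mem_range] at hi
    exact span_X_pow_mono a h (show 2 ≤ d - (d - 1 - (i + 1)) by omega)
      (Ideal.mem_span_insert.mpr ⟨0, _, hasseDeriv_single_pow_mem_span c (d - 1 - (i + 1)) d h,
        by rw [zero_mul, zero_add]⟩)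
  -- (ii) `u^d·DG − u^{d−1}·D(uG) ∈ (x_a, h²)` by peeling
  have hK : u ^ d * hasseDeriv (Finsupp.single c (d - 1)) G -
      u ^ (d - 1) * hasseDeriv (Finsupp.single c (d - 1)) (u * G) ∈
      Ideal.span {(X a : MvPolynomial (Fin 4) K), h ^ 2} := by
    have hexp := hasseDeriv_single_mul c (d - 1) u G
    rw [Finset.sum_range_succ', hasseDeriv_single_zero', Nat.sub_zero] at hexp
    have hsum : u ^ d * hasseDeriv (Finsupp.single c (d - 1)) G -
        u ^ (d - 1) * hasseDeriv (Finsupp.single c (d - 1)) (u * G) =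
        -∑ i ∈ Finset.range (d - 1), u ^ (d - 1) * (hasseDeriv (Finsupp.single c (i + 1)) u *
          hasseDeriv (Finsupp.single c (d - 1 - (i + 1))) G) := by
      rw [hexp, mul_add, Finset.mul_sum, show u ^ d = u ^ (d - 1) * u by rw [← pow_succ]; congr 1; omega]
      ring
    rw [hsum]
    refine Submodule.neg_mem _ (Ideal.sum_mem _ fun i hi => ?_)
    rw [Finset.mem_range] at hi
    have hrec := pow_mul_hasseDeriv_single_mem_span hca hG (d - 1 - (i + 1))
    have hsplit : u ^ (d - 1) * (hasseDeriv (Finsupp.single c (i + 1)) u *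
        hasseDeriv (Finsupp.single c (d - 1 - (i + 1))) G) =
        u ^ (d - 1 - (d - 1 - (i + 1) + 1)) * hasseDeriv (Finsupp.single c (i + 1)) u *
          (u ^ (d - 1 - (i + 1) + 1) * hasseDeriv (Finsupp.single c (d - 1 - (i + 1))) G) := by
      rw [show u ^ (d - 1) = u ^ (d - 1 - (d - 1 - (i + 1) + 1)) * u ^ (d - 1 - (i + 1) + 1) by
        rw [← pow_add]; congr 1; omega]
      ring
    rw [hsplit]
    exact Ideal.mul_mem_left _ _ (span_X_pow_mono a h (by omega) hrec)
  -- (iii) assemble: `u^d DG − u^{d−1}·d·T·h·hasseDeriv (Finsupp.single c 1) h^{d−1} = e·x_a + f·h²`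
  have hmem := Ideal.add_mem _ hK (Ideal.mul_mem_left _ (u ^ (d - 1)) hJ)
  rw [show u ^ d * hasseDeriv (Finsupp.single c (d - 1)) G -
      u ^ (d - 1) * hasseDeriv (Finsupp.single c (d - 1)) (u * G) +
      u ^ (d - 1) * (hasseDeriv (Finsupp.single c (d - 1)) (u * G) - T * (↑d * h * hasseDeriv (Finsupp.single c 1) h ^ (d - 1))) =
      u ^ d * hasseDeriv (Finsupp.single c (d - 1)) G - u ^ (d - 1) * T * (↑d * h * hasseDeriv (Finsupp.single c 1) h ^ (d - 1)) by ring] at hmem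
  obtain ⟨e, f, hef⟩ := Ideal.mem_span_pair.mp hmem
  refine ⟨e, f * h + u ^ (d - 1) * (d : MvPolynomial (Fin 4) K) * T * hasseDeriv (Finsupp.single c 1) h ^ (d - 1), ?_, ?_⟩
  · linear_combination -hef
  · have hh0 : MvPolynomial.eval (0 : Fin 4 → K) h = 0 := by
      unfold originIdeal at hh
      exact (RingHom.mem_ker).mp hh
    simp only [map_add, map_mul, map_pow, map_natCast, hh0, mul_zero, zero_add]


/-- **GENERIC LEDGER ⇒ HASSE LEDGER** (slice-B architecture (K8), explicit cofactors): if
`u·G = S·x_a + T·h^d` with `u(0), T(0) ≠ 0`, `h ∈ 𝔪₀`, `1 ≤ d < p`, and the letter `c ≠ a` carries `h` to first order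
(`(D_c^{(1)} h)(0) ≠ 0`), then `u′·G ∈ (x_a, (D_c^{(d−1)} G)^d)` for some `u′(0) ≠ 0`: the boundary ledger of `E_a`
transfers from ANY contact polynomial `h` to the Hasse contact polynomial of `G` in the letter `c`.  (So two ledgers
`(a, h_a)`, `(b, h_b)` meet in the common `D_c^{(d−1)} G`, `c ∉ {a, b}` — then `…IsolatedPowerIdeal` merges and kills.)
[OURS] [cite: EGAIV4, Thm. 16.11.2 (16.11.2.2)] -/
theorem exists_unit_mul_mem_span_X_hasseDeriv_pow (p : ℕ) [Fact p.Prime] [CharP K p] {a c : Fin 4}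
    (hca : c ≠ a) {d : ℕ} (hd : 1 ≤ d) (hdp : d < p) {G h u S T : MvPolynomial (Fin 4) K}
    (hh : h ∈ originIdeal K) (hG : u * G = S * X a + T * h ^ d) (hu : MvPolynomial.eval (0 : Fin 4 → K) u ≠ 0)
    (hT : MvPolynomial.eval (0 : Fin 4 → K) T ≠ 0)
    (hc : MvPolynomial.eval (0 : Fin 4 → K) (hasseDeriv (Finsupp.single c 1) h) ≠ 0) :
    ∃ u' : MvPolynomial (Fin 4) K, MvPolynomial.eval (0 : Fin 4 → K) u' ≠ 0 ∧
      u' * G ∈ Ideal.span {(X a : MvPolynomial (Fin 4) K), hasseDeriv (Finsupp.single c (d - 1)) G ^ d} := by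
  obtain ⟨e, w, hew, hw0⟩ := exists_pow_mul_hasseDeriv_eq hca hd hh hG
  have hw : MvPolynomial.eval (0 : Fin 4 → K) w ≠ 0 := by
    rw [hw0]
    exact mul_ne_zero (mul_ne_zero (mul_ne_zero (pow_ne_zero _ hu) (ResCone.natCast_ne_zero_of_lt p hd hdp)) hT)
      (pow_ne_zero _ hc)
  refine ⟨w ^ d * u, by rw [map_mul, map_pow]; exact mul_ne_zero (pow_ne_zero _ hw) hu, ?_⟩
  set D := hasseDeriv (Finsupp.single c (d - 1)) G with hD
  -- `(h·w)^d = (u^d·D − e·x_a)^d ∈ (x_a, D^d)`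
  have hhw : (h * w) ^ d ∈ Ideal.span {(X a : MvPolynomial (Fin 4) K), D ^ d} := by
    have heq : h * w = u ^ d * D - e * X a := by rw [hew]; ring
    obtain ⟨t, ht⟩ := sub_dvd_pow_sub_pow (u ^ d * D - e * X a) (u ^ d * D) d
    have hsplit : (h * w) ^ d = (u ^ d) ^ d * D ^ d + (-(e * t)) * X a := by
      rw [heq, ← mul_pow, show (u ^ d * D - e * X a) ^ d = (u ^ d * D) ^ d + ((u ^ d * D - e * X a) ^ d - (u ^ d * D) ^ d)
        by ring, ht]
      ring
    rw [hsplit]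
    exact Ideal.add_mem _ (Ideal.mul_mem_left _ _ (Ideal.subset_span (by simp)))
      (Ideal.mul_mem_left _ _ (Ideal.subset_span (by simp)))
  have hfinal : w ^ d * u * G = (w ^ d * S) * X a + T * (h * w) ^ d := by
    rw [mul_assoc, hG]; ring
  rw [hfinal]
  exact Ideal.add_mem _ (Ideal.mul_mem_left _ _ (Ideal.subset_span (by simp))) (Ideal.mul_mem_left _ _ hhw)

/-! ## 4. The cofactor `T` is a unit when `G` has a degree-`d` monomial off `x_a` -/

/-- Monomials of a power. [folklore] -/
theorem forall_le_degree_pow' {Q : MvPolynomial (Fin 4) K} {n : ℕ} (hQ : ∀ e ∈ Q.support, n ≤ e.degree) :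
    ∀ d : ℕ, ∀ e ∈ (Q ^ d).support, d * n ≤ e.degree := by
  intro d
  induction d with
  | zero => intro e _; rw [Nat.zero_mul]; exact Nat.zero_le _
  | succ d ih =>
    intro e he
    rw [pow_succ] at he
    have := ResCone.forall_le_degree_mul ih hQ e he
    rw [Nat.succ_mul]; exact this

/-- A polynomial vanishing at the origin has only monomials of positive degree. [folklore] -/
theorem forall_one_le_degree_of_eval_zero {P : MvPolynomial (Fin 4) K} (hP : MvPolynomial.eval (0 : Fin 4 → K) P = 0) :
    ∀ e ∈ P.support, 1 ≤ e.degree := by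
  intro e he
  rw [Nat.one_le_iff_ne_zero, Ne, Finsupp.degree_eq_zero_iff]
  rintro rfl
  rw [MvPolynomial.eval_zero, constantCoeff_eq] at hP
  exact (MvPolynomial.mem_support_iff.mp he) hP

/-- **The cofactor is a unit**: from `u·G = S·x_a + T·h^d` with `h ∈ 𝔪₀`, `u(0) ≠ 0`, `ord₀ G ≥ d` and a degree-`d`
monomial of `G` with `x_a`-exponent `0`, the cofactor satisfies `T(0) ≠ 0`. [folklore] -/
theorem eval_cofactor_ne_zero {a : Fin 4} {d : ℕ} {G h u S T : MvPolynomial (Fin 4) K} (hh : h ∈ originIdeal K)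
    (hG : u * G = S * X a + T * h ^ d) (hu : MvPolynomial.eval (0 : Fin 4 → K) u ≠ 0)
    (hordG : ∀ e ∈ G.support, d ≤ e.degree) {μ : Fin 4 →₀ ℕ} (hμa : μ a = 0) (hμd : μ.degree = d)
    (hμ : coeff μ G ≠ 0) : MvPolynomial.eval (0 : Fin 4 → K) T ≠ 0 := by
  classical
  intro hT
  have hh0 : MvPolynomial.eval (0 : Fin 4 → K) h = 0 := by
    unfold originIdeal at hh; exact (RingHom.mem_ker).mp hh
  -- `coeff_μ (u·G) = u(0) · coeff_μ G`
  have hL : coeff μ (u * G) = MvPolynomial.eval (0 : Fin 4 → K) u * coeff μ G := by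
    rw [coeff_mul, Finset.sum_eq_single ((0 : Fin 4 →₀ ℕ), μ)]
    · rw [MvPolynomial.eval_zero, constantCoeff_eq]
    · rintro ⟨α, β⟩ hmem hne
      rw [Finset.HasAntidiagonal.mem_antidiagonal] at hmem
      have hmem' : α + β = μ := hmem
      by_cases hβ : β ∈ G.support
      · exfalso
        have h1 := hordG β hβ
        have h2 : α.degree + β.degree = d := by rw [← map_add, hmem', hμd]
        have hα : α = 0 := (Finsupp.degree_eq_zero_iff _).mp (by omega)
        apply hne
        rw [hα, zero_add] at hmem'
        rw [hα, hmem']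
      · rw [MvPolynomial.notMem_support_iff.mp hβ, mul_zero]
    · intro h; exact absurd (Finset.HasAntidiagonal.mem_antidiagonal.mpr (zero_add μ)) h
  -- `coeff_μ (S·x_a) = 0` and `coeff_μ (T·h^d) = 0`
  have hR1 : coeff μ (S * X a) = 0 := by
    rw [coeff_mul_X', if_neg]
    rw [Finsupp.mem_support_iff, hμa]; exact fun h => h rfl
  have hR2 : coeff μ (T * h ^ d) = 0 := by
    by_contra hne
    have hdeg := ResCone.forall_le_degree_mul (forall_one_le_degree_of_eval_zero hT)
      (forall_le_degree_pow' (forall_one_le_degree_of_eval_zero hh0) d) μ (MvPolynomial.mem_support_iff.mpr hne)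
    rw [hμd, Nat.mul_one] at hdeg
    omega
  have h := congrArg (coeff μ) hG
  rw [hL, coeff_add, hR1, hR2, add_zero] at h
  exact mul_ne_zero hu hμ h

/-- **(K8) in membership form**: `u·G ∈ (x_a, h^d)`, `u(0) ≠ 0`, `h ∈ 𝔪₀` carried by the letter `c ≠ a`, `1 ≤ d < p`,
`ord₀ G ≥ d` with a degree-`d` monomial off `x_a` ⇒ `u′·G ∈ (x_a, (D_c^{(d−1)} G)^d)` for some `u′(0) ≠ 0`. [OURS]
[cite: EGAIV4, Thm. 16.11.2 (16.11.2.2)] -/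
theorem exists_unit_mul_mem_span_X_hasseDeriv_pow_of_mem (p : ℕ) [Fact p.Prime] [CharP K p] {a c : Fin 4}
    (hca : c ≠ a) {d : ℕ} (hd : 1 ≤ d) (hdp : d < p) {G h u : MvPolynomial (Fin 4) K}
    (hh : h ∈ originIdeal K) (hG : u * G ∈ Ideal.span {(X a : MvPolynomial (Fin 4) K), h ^ d})
    (hu : MvPolynomial.eval (0 : Fin 4 → K) u ≠ 0)
    (hc : MvPolynomial.eval (0 : Fin 4 → K) (hasseDeriv (Finsupp.single c 1) h) ≠ 0)
    (hordG : ∀ e ∈ G.support, d ≤ e.degree) {μ : Fin 4 →₀ ℕ} (hμa : μ a = 0) (hμd : μ.degree = d)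
    (hμ : coeff μ G ≠ 0) :
    ∃ u' : MvPolynomial (Fin 4) K, MvPolynomial.eval (0 : Fin 4 → K) u' ≠ 0 ∧
      u' * G ∈ Ideal.span {(X a : MvPolynomial (Fin 4) K), hasseDeriv (Finsupp.single c (d - 1)) G ^ d} := by
  obtain ⟨S, T, hST⟩ := Ideal.mem_span_pair.mp hG
  have hG' : u * G = S * X a + T * h ^ d := hST.symm
  exact exists_unit_mul_mem_span_X_hasseDeriv_pow p hca hd hdp hh hG' hu
    (eval_cofactor_ne_zero hh hG' hu hordG hμa hμd hμ) hc

end IsolatedBand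

end Summit.ResolutionOfSingularities.ResolutionOfSingularities.Theorems.PIDim4

end
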